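import Mathlib

/-!
# No six common neighbours of a bond (stub `stub_noSixCommonNeighbours` of `GapTwelveToBarlow`)

Sign lemma of the geometric half (card `cone-deficit-fivefold-sparsity`) of the line `Sketch` for
the crux `SquareWellLayerCake.GapTwelveToBarlow` (item stmt-AtomisticToContinuum-15807): in a
`55/57`-separated point configuration of `ℝ³`, a bonded pair `i ≠ j` (distance `≤ 1`) has at
most FIVE common neighbours within distance `1` — six near-regular tetrahedra never close up
around a bond.

## Proof

Write `d = |xᵢ - xⱼ| ∈ [55/57, 1]`, `u = (xⱼ - xᵢ)/d`, and for every site `k` let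
`s_k = ⟪x_k - xᵢ, u⟫` (axial coordinate) and `P_k = x_k - xᵢ - s_k u ⊥ u` (transversal part).
For a common neighbour `k` the squared distances `|x_k - xᵢ|² = |P_k|² + s_k²` and
`|x_k - xⱼ|² = |P_k|² + (s_k - d)²` both lie in `[(55/57)², 1]`, which pins `s_k ∈ [2/5, 3/5]`
(`axial_window`), hence `|P_k|² ≤ 21/25` and `P_k ≠ 0`; for two common neighbours
`(s_k - s_l)² ≤ 3/500` (`axial_diff_sq_le`) and `|x_k - x_l|² = |P_k - P_l|² + (s_k - s_l)²`, so
`|P_k - P_l|² ≥ (55/57)² - 3/500 > 21/25 ≥ |P_k|² + |P_l|² - |P_k| |P_l|`, i.e.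
`⟪P_k, P_l⟫ < |P_k| |P_l| / 2` (`inner_lt_half_mul_of_bounds`): the unit transversal directions
are pairwise at distance `> 1`.  They live in the plane `u^⊥`, which
`OrthonormalBasis.fromOrthogonalSpanSingleton` + `Complex.isometryOfOrthonormal` identify
isometrically with `ℂ`; and at most five unit complex numbers are pairwise at distance `> 1`
(`card_le_five_of_one_lt_norm_sub`): rotate one of them to `1`, the others have argument of
modulus `> π/3`, the bins `⌈3·arg/π⌉ ∈ {-2, -1, 2, 3}` receive at most one each
(`card_le_four_of_separated_angles`, pigeonhole), so there are at most `1 + 4` of them.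

Mathlib only; no named fact is used.
-/

noncomputable section

namespace Summit.AtomisticToContinuum.Crystallization.Theorems.SquareWellLayerCakeGapTwelveToBarlow

open scoped InnerProductSpace ComplexConjugate Real

/-! ## Planar part: at most five unit complex numbers pairwise more than `1` apart -/

/-- Pigeonhole on a circle: reals `a k ∈ (-π, π]` (`k ∈ T`) with `π/3 < |a k|` and pairwise
`π/3 < |a k - a l|` number at most four — the bins `⌈3 a_k / π⌉ ∈ {-2, -1, 2, 3}` are pairwise
distinct. [folklore] -/
theorem card_le_four_of_separated_angles {ι : Type*} (T : Finset ι) (a : ι → ℝ)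
    (hle : ∀ k ∈ T, a k ≤ π) (hgt : ∀ k ∈ T, -π < a k) (h0 : ∀ k ∈ T, π / 3 < |a k|)
    (h2 : ∀ k ∈ T, ∀ l ∈ T, k ≠ l → π / 3 < |a k - a l|) : T.card ≤ 4 := by
  by_contra! hT
  have hpi : 0 < π := Real.pi_pos
  have hmaps : Set.MapsTo (fun k => ⌈a k * 3 / π⌉) (T : Set ι)
      (({-2, -1, 2, 3} : Finset ℤ) : Set ℤ) := by
    intro k hk
    rw [Finset.mem_coe] at hk
    have hk1 := h0 k hk
    have hkle := hle k hk
    have hkgt := hgt k hk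
    simp only [Finset.coe_insert, Finset.coe_singleton, Set.mem_insert_iff,
      Set.mem_singleton_iff]
    rcases lt_abs.mp hk1 with h | h
    · have hb1 : (1 : ℝ) < a k * 3 / π := by rw [lt_div_iff₀ hpi]; linarith
      have hb3 : a k * 3 / π ≤ 3 := by rw [div_le_iff₀ hpi]; linarith
      have i1 : (1 : ℤ) < ⌈a k * 3 / π⌉ := Int.lt_ceil.mpr (by exact_mod_cast hb1)
      have i2 : ⌈a k * 3 / π⌉ ≤ 3 := Int.ceil_le.mpr (by exact_mod_cast hb3)
      omega
    · have hb1 : a k * 3 / π ≤ -1 := by rw [div_le_iff₀ hpi]; linarith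
      have hb3 : (-3 : ℝ) < a k * 3 / π := by rw [lt_div_iff₀ hpi]; linarith
      have i1 : ⌈a k * 3 / π⌉ ≤ -1 := Int.ceil_le.mpr (by exact_mod_cast hb1)
      have i2 : (-3 : ℤ) < ⌈a k * 3 / π⌉ := Int.lt_ceil.mpr (by exact_mod_cast hb3)
      omega
  have hcard : ({-2, -1, 2, 3} : Finset ℤ).card < T.card := lt_of_le_of_lt Finset.card_le_four hT
  obtain ⟨k, hk, l, hl, hne, hfeq⟩ := Finset.exists_ne_map_eq_of_card_lt_of_maps_to hcard hmaps
  have hkl := h2 k hk l hl hne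
  have hfeq' : ⌈a k * 3 / π⌉ = ⌈a l * 3 / π⌉ := hfeq
  have hcast : ((⌈a k * 3 / π⌉ : ℤ) : ℝ) = ((⌈a l * 3 / π⌉ : ℤ) : ℝ) := by rw [hfeq']
  have hk_le := Int.le_ceil (a k * 3 / π)
  have hk_lt := Int.ceil_lt_add_one (a k * 3 / π)
  have hl_le := Int.le_ceil (a l * 3 / π)
  have hl_lt := Int.ceil_lt_add_one (a l * 3 / π)
  have e : (a k * 3 / π - a l * 3 / π) * π = a k * 3 - a l * 3 := by
    rw [sub_mul, div_mul_cancel₀ _ hpi.ne', div_mul_cancel₀ _ hpi.ne']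
  have h1 := mul_lt_mul_of_pos_right (show a k * 3 / π - a l * 3 / π < 1 by linarith) hpi
  have h1' := mul_lt_mul_of_pos_right (show -1 < a k * 3 / π - a l * 3 / π by linarith) hpi
  rw [e] at h1 h1'
  have : |a k - a l| < π / 3 := by rw [abs_lt]; constructor <;> linarith
  linarith

/-- **At most five unit complex numbers are pairwise more than `1` apart** (equivalently: at
most five unit vectors of a plane have pairwise angles `> π/3`).  Rotate one of them, `z k₀`,
to `1`; the others `w_k = z_k conj (z k₀)` have `cos (arg w_k) < 1/2` and pairwise
`cos (arg w_k - arg w_l) < 1/2`, and `card_le_four_of_separated_angles` applies. [folklore] -/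
theorem card_le_five_of_one_lt_norm_sub {ι : Type*} (S : Finset ι) (z : ι → ℂ)
    (h1 : ∀ k ∈ S, ‖z k‖ = 1) (h2 : ∀ k ∈ S, ∀ l ∈ S, k ≠ l → 1 < ‖z k - z l‖) :
    S.card ≤ 5 := by
  classical
  by_contra! hS
  obtain ⟨k₀, hk₀⟩ : S.Nonempty := Finset.card_pos.mp (by omega)
  -- real coordinates
  have hunit : ∀ k ∈ S, (z k).re * (z k).re + (z k).im * (z k).im = 1 := by
    intro k hk
    rw [← Complex.normSq_apply, Complex.normSq_eq_norm_sq, h1 k hk, one_pow]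
  have hip : ∀ k ∈ S, ∀ l ∈ S, k ≠ l → (z k).re * (z l).re + (z k).im * (z l).im < 1 / 2 := by
    intro k hk l hl hne
    have h := h2 k hk l hl hne
    have hsq : 1 < ‖z k - z l‖ ^ 2 := by nlinarith [norm_nonneg (z k - z l)]
    rw [Complex.sq_norm, Complex.normSq_apply, Complex.sub_re, Complex.sub_im] at hsq
    nlinarith [hunit k hk, hunit l hl]
  -- rotate `z k₀` to `1`
  have hc := hunit k₀ hk₀
  have hw1 : ∀ k ∈ S, ‖z k * conj (z k₀)‖ = 1 := by
    intro k hk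
    rw [norm_mul, Complex.norm_conj, h1 k hk, h1 k₀ hk₀, one_mul]
  have hcos : ∀ k ∈ S, Real.cos (Complex.arg (z k * conj (z k₀))) = (z k * conj (z k₀)).re := by
    intro k hk
    have := Complex.norm_mul_cos_arg (z k * conj (z k₀))
    rwa [hw1 k hk, one_mul] at this
  have hsin : ∀ k ∈ S, Real.sin (Complex.arg (z k * conj (z k₀))) = (z k * conj (z k₀)).im := by
    intro k hk
    have := Complex.norm_mul_sin_arg (z k * conj (z k₀))
    rwa [hw1 k hk, one_mul] at this
  have hre : ∀ k, (z k * conj (z k₀)).re = (z k).re * (z k₀).re + (z k).im * (z k₀).im := by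
    intro k
    simp only [Complex.mul_re, Complex.conj_re, Complex.conj_im]
    ring
  have hprod : ∀ k l, (z k * conj (z k₀)).re * (z l * conj (z k₀)).re +
      (z k * conj (z k₀)).im * (z l * conj (z k₀)).im =
      (z k).re * (z l).re + (z k).im * (z l).im := by
    intro k l
    simp only [Complex.mul_re, Complex.mul_im, Complex.conj_re, Complex.conj_im]
    linear_combination ((z k).re * (z l).re + (z k).im * (z l).im) * hc
  have hpi : 0 < π := Real.pi_pos
  refine absurd (card_le_four_of_separated_angles (S.erase k₀)
    (fun k => Complex.arg (z k * conj (z k₀))) (fun k _ => Complex.arg_le_pi _)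
    (fun k _ => Complex.neg_pi_lt_arg _) ?_ ?_) ?_
  · intro k hk
    rw [Finset.mem_erase] at hk
    show π / 3 < |Complex.arg (z k * conj (z k₀))|
    by_contra! hle
    have := Real.cos_le_cos_of_nonneg_of_le_pi (abs_nonneg _) (by linarith) hle
    rw [Real.cos_pi_div_three, Real.cos_abs, hcos k hk.2, hre] at this
    linarith [hip k hk.2 k₀ hk₀ hk.1]
  · intro k hk l hl hne
    rw [Finset.mem_erase] at hk hl
    show π / 3 < |Complex.arg (z k * conj (z k₀)) - Complex.arg (z l * conj (z k₀))|
    by_contra! hle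
    have := Real.cos_le_cos_of_nonneg_of_le_pi (abs_nonneg _) (by linarith) hle
    rw [Real.cos_pi_div_three, Real.cos_abs, Real.cos_sub, hcos k hk.2, hcos l hl.2,
      hsin k hk.2, hsin l hl.2, hprod] at this
    linarith [hip k hk.2 l hl.2 hne]
  · rw [Finset.card_erase_of_mem hk₀]
    omega

/-! ## Metric part: the transversal directions of the common neighbours of a bond -/

/-- Pythagoras along a unit axis: `|Q + r u|² = |Q|² + r²` for `Q ⊥ u`, `|u| = 1`. [folklore] -/
theorem norm_add_smul_sq_of_inner_eq_zero {E : Type*} [NormedAddCommGroup E]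
    [InnerProductSpace ℝ E] {u Q : E} (hu : ‖u‖ = 1) (hQ : ⟪Q, u⟫_ℝ = 0) (r : ℝ) :
    ‖Q + r • u‖ ^ 2 = ‖Q‖ ^ 2 + r ^ 2 := by
  rw [norm_add_sq_real, real_inner_smul_right, hQ, norm_smul, hu, Real.norm_eq_abs, mul_one,
    mul_zero, mul_zero, add_zero, sq_abs]

/-- Axial window of a common neighbour: if `A = ρ² + s²` and `B = ρ² + (s - d)²` both lie in
`[(55/57)², 1]` and `d ∈ [55/57, 1]`, then `s ∈ [2/5, 3/5]`. [folklore] -/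
theorem axial_window {d A B ρ2 s : ℝ} (hd1 : 55 / 57 ≤ d) (hd2 : d ≤ 1)
    (hA1 : (55 / 57 : ℝ) ^ 2 ≤ A) (hA2 : A ≤ 1) (hB1 : (55 / 57 : ℝ) ^ 2 ≤ B) (hB2 : B ≤ 1)
    (hA : A = ρ2 + s ^ 2) (hB : B = ρ2 + (s - d) ^ 2) : 2 / 5 ≤ s ∧ s ≤ 3 / 5 := by
  have hsd : 2 * s * d = A - B + d ^ 2 := by rw [hA, hB]; ring
  have hdpos : 0 < d := by linarith
  constructor
  · by_contra! h
    nlinarith [mul_lt_mul_of_pos_right h hdpos,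
      mul_nonneg (sub_nonneg.2 hd1) (show (0 : ℝ) ≤ d + 55 / 57 - 4 / 5 by linarith)]
  · by_contra! h
    nlinarith [mul_lt_mul_of_pos_right h hdpos,
      mul_nonpos_iff.mpr (Or.inl ⟨sub_nonneg.2 hd1, sub_nonpos.2 hd2⟩)]

/-- Two common neighbours have nearly equal axial coordinates: `(s_k - s_l)² ≤ 3/500`.
[folklore] -/
theorem axial_diff_sq_le {d Ak Bk Al Bl sk sl ρk2 ρl2 : ℝ} (hd1 : 55 / 57 ≤ d)
    (hAk1 : (55 / 57 : ℝ) ^ 2 ≤ Ak) (hAk2 : Ak ≤ 1) (hBk1 : (55 / 57 : ℝ) ^ 2 ≤ Bk)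
    (hBk2 : Bk ≤ 1) (hAl1 : (55 / 57 : ℝ) ^ 2 ≤ Al) (hAl2 : Al ≤ 1)
    (hBl1 : (55 / 57 : ℝ) ^ 2 ≤ Bl) (hBl2 : Bl ≤ 1)
    (hAk : Ak = ρk2 + sk ^ 2) (hBk : Bk = ρk2 + (sk - d) ^ 2)
    (hAl : Al = ρl2 + sl ^ 2) (hBl : Bl = ρl2 + (sl - d) ^ 2) :
    (sk - sl) ^ 2 ≤ 3 / 500 := by
  have hk : 2 * sk * d = Ak - Bk + d ^ 2 := by rw [hAk, hBk]; ring
  have hl : 2 * sl * d = Al - Bl + d ^ 2 := by rw [hAl, hBl]; ring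
  have h1 : 2 * (sk - sl) * d ≤ 2 * (1 - (55 / 57 : ℝ) ^ 2) := by linarith
  have h2 : -(2 * (1 - (55 / 57 : ℝ) ^ 2)) ≤ 2 * (sk - sl) * d := by linarith
  have h3 := sq_le_sq' h2 h1
  have hd2 : (55 / 57 : ℝ) ^ 2 ≤ d ^ 2 := pow_le_pow_left₀ (by norm_num) hd1 2
  nlinarith [mul_le_mul_of_nonneg_left hd2 (sq_nonneg (sk - sl))]

/-- The transversal parts of two common neighbours make an angle `> π/3`:
`⟪P_k, P_l⟫ < |P_k| |P_l| / 2` from `|P_k|², |P_l|² ≤ 21/25` and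
`|P_k - P_l|² ≥ (55/57)² - 3/500`. [folklore] -/
theorem inner_lt_half_mul_of_bounds {ρk ρl ip n2 : ℝ} (hk0 : 0 ≤ ρk) (hl0 : 0 ≤ ρl)
    (hk : ρk ^ 2 ≤ 21 / 25) (hl : ρl ^ 2 ≤ 21 / 25)
    (hn : n2 = ρk ^ 2 - 2 * ip + ρl ^ 2) (hn2 : (55 / 57 : ℝ) ^ 2 - 3 / 500 ≤ n2) :
    ip < ρk * ρl / 2 := by
  rcases le_total ρk ρl with h | h
  · nlinarith [mul_le_mul_of_nonneg_left h hk0]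
  · nlinarith [mul_le_mul_of_nonneg_left h hl0]

/-- **No six common neighbours** (`stub_noSixCommonNeighbours`, the sign lemma of card
`cone-deficit-fivefold-sparsity`): among points of `ℝ³` pairwise at distance `≥ 55/57`, a
bonded pair `i ≠ j` (`|xᵢ - xⱼ| ≤ 1`) has at most five common neighbours within distance `1`.
The unit transversal directions of the common neighbours (relative to the bond axis) are
pairwise more than `1` apart in the plane orthogonal to the axis, which is isometric to `ℂ`,
and `card_le_five_of_one_lt_norm_sub` concludes. [folklore] -/
theorem stub_noSixCommonNeighbours :
    ∀ (N : ℕ) (x : Fin N → EuclideanSpace ℝ (Fin 3)) (i j : Fin N), i ≠ j →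
      (∀ k l : Fin N, k ≠ l → (55 : ℝ) / 57 ≤ dist (x k) (x l)) → dist (x i) (x j) ≤ 1 →
      (Finset.univ.filter fun k : Fin N =>
        k ≠ i ∧ k ≠ j ∧ dist (x i) (x k) ≤ 1 ∧ dist (x j) (x k) ≤ 1).card ≤ 5 := by
  intro N x i j hij hsep hdij
  have hδd : (55 : ℝ) / 57 ≤ dist (x i) (x j) := hsep i j hij
  -- the bond length `d` and the unit axis `u`
  obtain ⟨d, hd⟩ : ∃ d : ℝ, d = dist (x i) (x j) := ⟨_, rfl⟩
  rw [← hd] at hδd hdij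
  have hdpos : 0 < d := lt_of_lt_of_le (by norm_num) hδd
  have hnorm_ji : ‖x j - x i‖ = d := by rw [hd, dist_eq_norm, norm_sub_rev]
  obtain ⟨u, hu⟩ : ∃ u : EuclideanSpace ℝ (Fin 3), u = d⁻¹ • (x j - x i) := ⟨_, rfl⟩
  have hu1 : ‖u‖ = 1 := by
    rw [hu, norm_smul, norm_inv, Real.norm_eq_abs, abs_of_pos hdpos, hnorm_ji,
      inv_mul_cancel₀ hdpos.ne']
  have huu : ⟪u, u⟫_ℝ = 1 := by rw [real_inner_self_eq_norm_sq, hu1, one_pow]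
  have hxji : x j - x i = d • u := by rw [hu, smul_smul, mul_inv_cancel₀ hdpos.ne', one_smul]
  -- axial coordinates `s` and transversal parts `P`
  obtain ⟨s, hs⟩ : ∃ s : Fin N → ℝ, ∀ k, s k = ⟪x k - x i, u⟫_ℝ := ⟨_, fun _ => rfl⟩
  obtain ⟨P, hP⟩ : ∃ P : Fin N → EuclideanSpace ℝ (Fin 3), ∀ k, P k = x k - x i - s k • u :=
    ⟨_, fun _ => rfl⟩
  have hPu : ∀ k, ⟪P k, u⟫_ℝ = 0 := by
    intro k
    rw [hP, inner_sub_left, real_inner_smul_left, huu, ← hs k]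
    ring
  have hki : ∀ k, x k - x i = P k + s k • u := by
    intro k
    rw [hP, sub_add_cancel]
  have hkj : ∀ k, x k - x j = P k + (s k - d) • u := by
    intro k
    rw [hP, sub_smul, ← hxji]
    abel
  have hkl : ∀ k l, x k - x l = (P k - P l) + (s k - s l) • u := by
    intro k l
    rw [hP, hP, sub_smul]
    abel
  have hA : ∀ k, ‖x k - x i‖ ^ 2 = ‖P k‖ ^ 2 + s k ^ 2 := by
    intro k
    rw [hki]
    exact norm_add_smul_sq_of_inner_eq_zero hu1 (hPu k) _
  have hB : ∀ k, ‖x k - x j‖ ^ 2 = ‖P k‖ ^ 2 + (s k - d) ^ 2 := by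
    intro k
    rw [hkj]
    exact norm_add_smul_sq_of_inner_eq_zero hu1 (hPu k) _
  have hD : ∀ k l, ‖x k - x l‖ ^ 2 = ‖P k - P l‖ ^ 2 + (s k - s l) ^ 2 := by
    intro k l
    rw [hkl]
    exact norm_add_smul_sq_of_inner_eq_zero hu1 (by rw [inner_sub_left, hPu, hPu, sub_zero]) _
  -- the common neighbours
  set S := Finset.univ.filter fun k : Fin N =>
    k ≠ i ∧ k ≠ j ∧ dist (x i) (x k) ≤ 1 ∧ dist (x j) (x k) ≤ 1 with hSdef
  have hmem : ∀ k ∈ S, k ≠ i ∧ k ≠ j ∧ dist (x i) (x k) ≤ 1 ∧ dist (x j) (x k) ≤ 1 :=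
    fun k hk => (Finset.mem_filter.mp hk).2
  have hsq : ∀ r : ℝ, 55 / 57 ≤ r → r ≤ 1 → (55 / 57 : ℝ) ^ 2 ≤ r ^ 2 ∧ r ^ 2 ≤ 1 :=
    fun r h1 h2 => ⟨pow_le_pow_left₀ (by norm_num) h1 2, pow_le_one₀ (by linarith) h2⟩
  have hAw : ∀ k ∈ S, (55 / 57 : ℝ) ^ 2 ≤ ‖x k - x i‖ ^ 2 ∧ ‖x k - x i‖ ^ 2 ≤ 1 := by
    intro k hk
    obtain ⟨hki', -, hik, -⟩ := hmem k hk
    refine hsq _ ?_ ?_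
    · rw [← dist_eq_norm]
      exact hsep k i hki'
    · rwa [← dist_eq_norm, dist_comm]
  have hBw : ∀ k ∈ S, (55 / 57 : ℝ) ^ 2 ≤ ‖x k - x j‖ ^ 2 ∧ ‖x k - x j‖ ^ 2 ≤ 1 := by
    intro k hk
    obtain ⟨-, hkj', -, hjk⟩ := hmem k hk
    refine hsq _ ?_ ?_
    · rw [← dist_eq_norm]
      exact hsep k j hkj'
    · rwa [← dist_eq_norm, dist_comm]
  have hsw : ∀ k ∈ S, 2 / 5 ≤ s k ∧ s k ≤ 3 / 5 := fun k hk =>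
    axial_window hδd hdij (hAw k hk).1 (hAw k hk).2 (hBw k hk).1 (hBw k hk).2 (hA k) (hB k)
  have hPle : ∀ k ∈ S, ‖P k‖ ^ 2 ≤ 21 / 25 := by
    intro k hk
    nlinarith [(hAw k hk).2, hA k, (hsw k hk).1]
  have hP0 : ∀ k ∈ S, P k ≠ 0 := by
    intro k hk h0
    have h0' : ‖P k‖ = 0 := by rw [h0, norm_zero]
    nlinarith [(hAw k hk).1, hA k, (hsw k hk).1, (hsw k hk).2]
  -- unit transversal directions are pairwise more than `1` apart
  have hfar : ∀ k ∈ S, ∀ l ∈ S, k ≠ l → 1 < ‖‖P k‖⁻¹ • P k - ‖P l‖⁻¹ • P l‖ := by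
    intro k hk l hl hne
    have hΔ : (s k - s l) ^ 2 ≤ 3 / 500 :=
      axial_diff_sq_le hδd (hAw k hk).1 (hAw k hk).2 (hBw k hk).1 (hBw k hk).2
        (hAw l hl).1 (hAw l hl).2 (hBw l hl).1 (hBw l hl).2 (hA k) (hB k) (hA l) (hB l)
    have hDkl : (55 / 57 : ℝ) ^ 2 ≤ ‖x k - x l‖ ^ 2 :=
      pow_le_pow_left₀ (by norm_num) (by rw [← dist_eq_norm]; exact hsep k l hne) 2
    have hipl : ⟪P k, P l⟫_ℝ < ‖P k‖ * ‖P l‖ / 2 :=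
      inner_lt_half_mul_of_bounds (norm_nonneg _) (norm_nonneg _) (hPle k hk) (hPle l hl)
        (norm_sub_sq_real (P k) (P l)) (by linarith [hD k l])
    have hk0 : 0 < ‖P k‖ := norm_pos_iff.mpr (hP0 k hk)
    have hl0 : 0 < ‖P l‖ := norm_pos_iff.mpr (hP0 l hl)
    have hvk : ‖‖P k‖⁻¹ • P k‖ = 1 := norm_smul_inv_norm (hP0 k hk)
    have hvl : ‖‖P l‖⁻¹ • P l‖ = 1 := norm_smul_inv_norm (hP0 l hl)
    have hvv : ⟪‖P k‖⁻¹ • P k, ‖P l‖⁻¹ • P l⟫_ℝ < 1 / 2 := by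
      rw [real_inner_smul_left, real_inner_smul_right, ← mul_assoc, ← mul_inv,
        inv_mul_lt_iff₀ (mul_pos hk0 hl0)]
      linarith
    have hsq2 : 1 < ‖‖P k‖⁻¹ • P k - ‖P l‖⁻¹ • P l‖ ^ 2 := by
      rw [norm_sub_sq_real, hvk, hvl]
      linarith
    nlinarith [norm_nonneg (‖P k‖⁻¹ • P k - ‖P l‖⁻¹ • P l)]
  -- the plane `u^⊥` is isometric to `ℂ`
  have hu0 : u ≠ 0 := fun h => by
    rw [h, norm_zero] at hu1
    exact zero_ne_one hu1
  haveI : Fact (Module.finrank ℝ (EuclideanSpace ℝ (Fin 3)) = 2 + 1) :=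
    ⟨by rw [finrank_euclideanSpace_fin]⟩
  let Φ : (ℝ ∙ u)ᗮ ≃ₗᵢ[ℝ] ℂ :=
    (Complex.isometryOfOrthonormal (OrthonormalBasis.fromOrthogonalSpanSingleton 2 hu0)).symm
  have hmemK : ∀ k, ‖P k‖⁻¹ • P k ∈ (ℝ ∙ u)ᗮ := fun k =>
    Submodule.mem_orthogonal_singleton_iff_inner_left.mpr
      (by rw [real_inner_smul_left, hPu k, mul_zero])
  refine card_le_five_of_one_lt_norm_sub S (fun k => Φ ⟨‖P k‖⁻¹ • P k, hmemK k⟩)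
    (fun k hk => ?_) (fun k hk l hl hne => ?_)
  · show ‖Φ ⟨‖P k‖⁻¹ • P k, hmemK k⟩‖ = 1
    rw [LinearIsometryEquiv.norm_map, Submodule.coe_norm, Submodule.coe_mk]
    exact norm_smul_inv_norm (hP0 k hk)
  · show 1 < ‖Φ ⟨‖P k‖⁻¹ • P k, hmemK k⟩ - Φ ⟨‖P l‖⁻¹ • P l, hmemK l⟩‖
    rw [← map_sub, LinearIsometryEquiv.norm_map, Submodule.coe_norm, Submodule.coe_sub,
      Submodule.coe_mk, Submodule.coe_mk]
    exact hfar k hk l hl hne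

end Summit.AtomisticToContinuum.Crystallization.Theorems.SquareWellLayerCakeGapTwelveToBarlow

end
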